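import Summits.ResolutionOfSingularities.ResolutionOfSingularities.Theorems.FrobeniusLadderFRationalResolutionFixedPointFibre
import Literature.RingTheory.GradedAlgebra.LocalizationDegreeZero
import Mathlib.RingTheory.Ideal.GoingUp
import Mathlib.RingTheory.Localization.AtPrime.Basic
import HarnessLib

/-!
# Crux `FrobeniusLadder.FRationalResolution` (stmt-ResolutionOfSingularities-15317), line `redirect`,
# stub `stub_diagonalizableQuotientResolution` — the local ring of `Spec S` at a FIXED point

For `S` graded by a TORSION abelian group `A` (`GradedAlgebra 𝒮`, `S₀ = 𝒮 0`; an action of the finite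
diagonalizable group scheme `D(A)` on `Spec S` with quotient `q : Spec S → Spec S₀`) and a `D(A)`-fixed prime `𝔔`
(one containing every `S_a`, `a ≠ 0`) with image `𝔔₀ = 𝔔 ∩ S₀`, this file proves the next structure lemma of
the local linearisation step (L3 of the census of leafhand-2 g0), after `…FixedPointFibre.lean` (the fibre
`q⁻¹(𝔔₀)` is the single point `𝔔`, `κ(𝔔) = κ(𝔔₀)`):

* `isUnit_of_not_mem_of_fixed` — **inverting the INVARIANT functions not vanishing at `𝔔₀` already inverts
  every function not vanishing at `𝔔`**: in `T⁻¹S`, `T = S₀ ∖ 𝔔₀`, every `s ∉ 𝔔` is a unit (a maximal ideal of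
  `T⁻¹S` containing `s` contracts to an ideal of `S` meeting `S₀` inside `𝔔₀`; going-up along the INTEGRAL
  extension `S₀ ⊆ S` produces a prime over `𝔔₀` containing it, which is `𝔔` by the one-point fibre — so
  `s ∈ 𝔔`, contradiction);
* `isLocalization_atPrime_of_fixed`, `isLocalization_algebraMapSubmonoid_of_fixed` — hence
  **`S_𝔔 = T⁻¹S = S ⊗_{S₀} (S₀)_{𝔔₀}`**: the local ring of `Spec S` at a fixed point is the base change of the
  local ring of the quotient;
* `isLocalization_atPrime_gradeZero_of_fixed` — consequently (with the tree's grading of localizations at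
  degree-`0` elements, `Literature.RingTheory.GradedAlgebra.locPiece`, EGA II (2.2.2)) **`S_𝔔` is `A`-graded and
  its degree-`0` part is `(S₀)_{𝔔₀}`: invariants commute with localization at a fixed point.**

Honest label: structure lemmas toward L3 (no stub closed). No definitions, no named facts, no sorry.
[folklore; cite: SGA3, Exp. VIII §§4–5; EGA II (2.2.1)–(2.2.2)]
-/

noncomputable section

-- single-problem summit: the doubled namespace component is forced
set_option linter.dupNamespace false

open DirectSum

namespace Summit.ResolutionOfSingularities.ResolutionOfSingularities.Theorems.FRationalResolution.FixedPointLocalization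

open Literature.AlgebraicGeometry.Resolution.DiagonalizableQuotient (algebra_isIntegral
  algebraMap_gradeZero_injective)
open Literature.RingTheory.GradedAlgebra
open FixedPointFibre (eq_of_isPrime_of_comap_eq)

universe u v w v'

variable {R : Type u} {S : Type v} {A : Type w} [CommRing R] [CommRing S] [Algebra R S]
  [DecidableEq A] [AddCommGroup A] (𝒮 : A → Submodule R S) [GradedAlgebra 𝒮]

/-- The invariant functions not vanishing at `𝔔₀ = 𝔔 ∩ S₀` do not vanish at `𝔔`. [folklore] -/
theorem algebraMapSubmonoid_le_primeCompl (𝔔 : Ideal S) [𝔔.IsPrime] :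
    Algebra.algebraMapSubmonoid S (𝔔.comap (algebraMap (𝒮 0) S)).primeCompl ≤ 𝔔.primeCompl := by
  rintro _ ⟨x, hx, rfl⟩
  exact hx

/-- The elements of `T = S₀ ∖ 𝔔₀`, mapped to `S`, are homogeneous of degree `0`. [folklore] -/
theorem algebraMapSubmonoid_mem_zero (𝔔 : Ideal S) [𝔔.IsPrime] :
    ∀ t ∈ Algebra.algebraMapSubmonoid S (𝔔.comap (algebraMap (𝒮 0) S)).primeCompl, t ∈ 𝒮 0 := by
  rintro _ ⟨x, -, rfl⟩
  exact x.2

/-- The pull-back of `T = S₀ ∖ 𝔔₀` (viewed in `S`) to `S₀` is `S₀ ∖ 𝔔₀` (`S₀ → S` is injective).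
[folklore] -/
theorem comap_algebraMapSubmonoid_eq (𝔔 : Ideal S) [𝔔.IsPrime] :
    (Algebra.algebraMapSubmonoid S (𝔔.comap (algebraMap (𝒮 0) S)).primeCompl).comap
        (algebraMap (𝒮 0) S) = (𝔔.comap (algebraMap (𝒮 0) S)).primeCompl := by
  ext x
  constructor
  · rintro ⟨y, hy, hxy⟩
    have hxy' : y = x := algebraMap_gradeZero_injective 𝒮 hxy
    rw [← hxy']
    exact hy
  · intro hx
    exact ⟨x, hx, rfl⟩

/-- **Inverting the invariants not vanishing at `𝔔₀` inverts everything not vanishing at the fixed point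
`𝔔`.** Let the grading group be torsion and `𝔔` a prime containing all `S_a`, `a ≠ 0`; let `L = T⁻¹S` for
`T = S₀ ∖ 𝔔₀` (`𝔔₀ = 𝔔 ∩ S₀`). Then every `s ∉ 𝔔` is a unit of `L`: otherwise a maximal ideal `𝔐 ∋ s` of `L`
contracts to an ideal `𝔓 ∋ s` of `S` with `𝔓 ∩ S₀ ⊆ 𝔔₀` (elements of `T` are units), going-up for the integral
extension `S₀ ⊆ S` (`algebra_isIntegral`) gives a prime `𝔓' ⊇ 𝔓` over `𝔔₀`, and `𝔓' = 𝔔` because the fibre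
over the image of a fixed point is one point (`FixedPointFibre.eq_of_isPrime_of_comap_eq`) — so `s ∈ 𝔔`.
[folklore; cite: SGA3, Exp. VIII §5] -/
theorem isUnit_of_not_mem_of_fixed (hA : AddMonoid.IsTorsion A) (𝔔 : Ideal S) [𝔔.IsPrime]
    (hfix : ∀ a : A, a ≠ 0 → ∀ s ∈ 𝒮 a, s ∈ 𝔔)
    (L : Type v') [CommRing L] [Algebra S L]
    [IsLocalization (Algebra.algebraMapSubmonoid S (𝔔.comap (algebraMap (𝒮 0) S)).primeCompl) L]
    {s : S} (hs : s ∉ 𝔔) : IsUnit (algebraMap S L s) := by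
  classical
  set 𝔔₀ := 𝔔.comap (algebraMap (𝒮 0) S) with h𝔔₀
  set T := Algebra.algebraMapSubmonoid S 𝔔₀.primeCompl with hT
  by_contra hunit
  obtain ⟨𝔐, h𝔐max, hle⟩ := Ideal.exists_le_maximal (Ideal.span {algebraMap S L s})
    (fun htop => hunit (Ideal.span_singleton_eq_top.mp htop))
  have hs𝔐 : algebraMap S L s ∈ 𝔐 := hle (Ideal.mem_span_singleton_self _)
  set 𝔓 : Ideal S := 𝔐.comap (algebraMap S L) with h𝔓
  have hs𝔓 : s ∈ 𝔓 := hs𝔐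
  -- `𝔓 ∩ S₀ ⊆ 𝔔₀`: elements of `T` are units of `L`, hence not in `𝔐`
  have hcomap : 𝔓.comap (algebraMap (𝒮 0) S) ≤ 𝔔₀ := by
    intro x hx
    by_contra hx0
    have hxT : algebraMap (𝒮 0) S x ∈ T := ⟨x, hx0, rfl⟩
    have hu : IsUnit (algebraMap S L (algebraMap (𝒮 0) S x)) := IsLocalization.map_units L ⟨_, hxT⟩
    exact h𝔐max.ne_top (Ideal.eq_top_of_isUnit_mem _ hx hu)
  -- going-up along the integral extension `S₀ ⊆ S`
  haveI := algebra_isIntegral 𝒮 hA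
  obtain ⟨𝔓', h𝔓𝔓', h𝔓'prime, h𝔓'comap⟩ := Ideal.exists_ideal_over_prime_of_isIntegral 𝔔₀ 𝔓 hcomap
  haveI := h𝔓'prime
  -- the fibre over `𝔔₀` is `{𝔔}`
  have heq : 𝔔 = 𝔓' := eq_of_isPrime_of_comap_eq 𝒮 hA 𝔔 𝔓' hfix (by rw [h𝔓'comap])
  have hsQ : s ∈ 𝔔 := by rw [heq]; exact h𝔓𝔓' hs𝔓
  exact hs hsQ

/-- **`S_𝔔 = T⁻¹S`, `T = S₀ ∖ 𝔔₀`, at a fixed point**: any localization of `S` at the invariant functions not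
vanishing at `𝔔₀` is a localization of `S` at the fixed prime `𝔔` (torsion grading group). Geometrically: the
local scheme of `Spec S` at a `D(A)`-fixed point is the base change `Spec S ×_{Spec S₀} Spec 𝒪_{Spec S₀, 𝔔₀}`.
[folklore; cite: SGA3, Exp. VIII §5] -/
theorem isLocalization_atPrime_of_fixed (hA : AddMonoid.IsTorsion A) (𝔔 : Ideal S) [𝔔.IsPrime]
    (hfix : ∀ a : A, a ≠ 0 → ∀ s ∈ 𝒮 a, s ∈ 𝔔)
    (L : Type v') [CommRing L] [Algebra S L]
    [IsLocalization (Algebra.algebraMapSubmonoid S (𝔔.comap (algebraMap (𝒮 0) S)).primeCompl) L] :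
    IsLocalization.AtPrime L 𝔔 :=
  IsLocalization.of_le (Algebra.algebraMapSubmonoid S (𝔔.comap (algebraMap (𝒮 0) S)).primeCompl)
    𝔔.primeCompl (algebraMapSubmonoid_le_primeCompl 𝒮 𝔔)
    (fun _ hs => isUnit_of_not_mem_of_fixed 𝒮 hA 𝔔 hfix L hs)

/-- **Conversely, every localization of `S` at the fixed prime `𝔔` is a localization at `T = S₀ ∖ 𝔔₀`** (the
two submonoids have the same localizations). [folklore; cite: SGA3, Exp. VIII §5] -/
theorem isLocalization_algebraMapSubmonoid_of_fixed (hA : AddMonoid.IsTorsion A) (𝔔 : Ideal S)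
    [𝔔.IsPrime] (hfix : ∀ a : A, a ≠ 0 → ∀ s ∈ 𝒮 a, s ∈ 𝔔)
    (L : Type v') [CommRing L] [Algebra S L] [IsLocalization.AtPrime L 𝔔] :
    IsLocalization (Algebra.algebraMapSubmonoid S (𝔔.comap (algebraMap (𝒮 0) S)).primeCompl) L := by
  set T := Algebra.algebraMapSubmonoid S (𝔔.comap (algebraMap (𝒮 0) S)).primeCompl with hT
  haveI : IsLocalization.AtPrime (Localization T) 𝔔 :=
    isLocalization_atPrime_of_fixed 𝒮 hA 𝔔 hfix (Localization T)
  exact (IsLocalization.isLocalization_iff_of_isLocalization (M := T) (N := 𝔔.primeCompl)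
    (Localization T) (P := L)).mpr inferInstance

/-- **Invariants commute with localization at a fixed point: `(S_𝔔)₀ = (S₀)_{𝔔₀}`.** For a torsion grading
and a fixed prime `𝔔`, any localization `L = S_𝔔` is the localization `T⁻¹S` at the degree-`0` submonoid
`T = S₀ ∖ 𝔔₀`, hence `A`-graded by the pieces `T⁻¹S_a` (`Literature.RingTheory.GradedAlgebra.locPiece`,
`nonempty_gradedAlgebra_locPiece`), and its degree-`0` piece is the local ring `(S₀)_{𝔔₀}` of the quotient at the
image point (EGA II (2.2.2), `isLocalization_locPiece_zero`). [folklore; cite: EGAII, (2.2.2)] -/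
theorem isLocalization_atPrime_gradeZero_of_fixed (hA : AddMonoid.IsTorsion A) (𝔔 : Ideal S)
    [𝔔.IsPrime] (hfix : ∀ a : A, a ≠ 0 → ∀ s ∈ 𝒮 a, s ∈ 𝔔)
    (L : Type v') [CommRing L] [Algebra S L] [Algebra R L] [IsScalarTower R S L]
    [IsLocalization.AtPrime L 𝔔] :
    letI := gradedMonoid_locPiece 𝒮
      (Algebra.algebraMapSubmonoid S (𝔔.comap (algebraMap (𝒮 0) S)).primeCompl)
      (algebraMapSubmonoid_mem_zero 𝒮 𝔔) L
    letI := locPieceZeroAlgebra 𝒮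
      (Algebra.algebraMapSubmonoid S (𝔔.comap (algebraMap (𝒮 0) S)).primeCompl)
      (algebraMapSubmonoid_mem_zero 𝒮 𝔔) L
    Nonempty (GradedAlgebra (locPiece 𝒮
        (Algebra.algebraMapSubmonoid S (𝔔.comap (algebraMap (𝒮 0) S)).primeCompl)
        (algebraMapSubmonoid_mem_zero 𝒮 𝔔) L)) ∧
      IsLocalization.AtPrime (locPiece 𝒮
        (Algebra.algebraMapSubmonoid S (𝔔.comap (algebraMap (𝒮 0) S)).primeCompl)
        (algebraMapSubmonoid_mem_zero 𝒮 𝔔) L 0) (𝔔.comap (algebraMap (𝒮 0) S)) := by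
  haveI := isLocalization_algebraMapSubmonoid_of_fixed 𝒮 hA 𝔔 hfix L
  refine ⟨nonempty_gradedAlgebra_locPiece 𝒮 _ (algebraMapSubmonoid_mem_zero 𝒮 𝔔) L, ?_⟩
  have h := isLocalization_locPiece_zero 𝒮
    (Algebra.algebraMapSubmonoid S (𝔔.comap (algebraMap (𝒮 0) S)).primeCompl)
    (algebraMapSubmonoid_mem_zero 𝒮 𝔔) L
  rw [comap_algebraMapSubmonoid_eq 𝒮 𝔔] at h
  exact h

end Summit.ResolutionOfSingularities.ResolutionOfSingularities.Theorems.FRationalResolution.FixedPointLocalization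

end
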